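import Literature.MathematicalPhysics.QuantumFieldTheory.Balaban1983to89.B9Eq359CubeKernelsKnitAtOne
import Literature.MathematicalPhysics.QuantumFieldTheory.Balaban1983to89.Node00.OpsYCubeDirInverseSymm
import Literature.MathematicalPhysics.QuantumFieldTheory.Balaban1983to89.Node00.OpsYLocalInverseSeq
import Literature.MathematicalPhysics.QuantumFieldTheory.Balaban1983to89.B9CubeDirInversePosOnNearHY
import Literature.MathematicalPhysics.QuantumFieldTheory.Balaban1983to89.B9WalkLettersOpsO
import Literature.MathematicalPhysics.QuantumFieldTheory.Balaban1983to89.B9Cor35GpDirInputsAtOne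

/-!
# `Balaban1983to89.B9CubeDirInverseKnitCubeLawsY` — T. Bałaban, *Propagators for lattice gauge theories in a background field*, Commun. Math. Phys. **99** (1985)
# 389–434 [Balaban1985BackgroundPropagators] (3.19) p. 393, (3.24)–(3.25) pp. 394–395, p. 394 L24–33 («Ω₀Δ′_aΩ₀ … Its inverse is denoted by G′ … They depend on the
# configuration `U` restricted to `Ω₀`»), p. 408 L40 – p. 409 L5 (the sequence `{Ω_n(□)}`, «G′_□(U)»), (3.87)–(3.88) p. 409, Thm 3.11 p. 416; T. Bałaban, *Averaging operations for
# lattice gauge theories*, Commun. Math. Phys. **98** (1985) 17–51 [Balaban1985Averaging] p. 24 (locality sentence after (43)), (52)–(53) p. 27: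
# ★★ **THE ALGEBRAIC LAW ROWS OF THE DIRICHLET CUBE INVERSE `G′_□(U) = GpDirY i □ (parKnitCubeY i □) S` AT THE CUBE SEQUENCE's OWN KNIT LETTER** — locality in `U`,
# the (3.87)–(3.88) local-inverse laws against the MEMBER's `Δ′_a(U; parKnitY)`, and the unit premise `IsUnit (Ω₀Δ′_{a,□}(U)Ω₀ ⊕ 1)` on EVERY exterior.

statement-level skeleton of published theorems with citation tags; proofs where landed; nothing here is a claim about the Yang–Mills mass gap

WHAT.  The N06 knit certificates («KE₉X-A» ∕ «KESC-A» and their editions) carry print's cube operator `G′_□(U)` of p. 409 as a letter `O x □` with four ALGEBRAIC law rows: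
locality `hOagr` (p. 394 «depend on `U` restricted to `Ω₀`»), symmetry `hOsym` (Thm 3.11), and the two local-inverse laws `hOloc` ∕ `hOlocT` of (3.87)–(3.88), the latter typed
against the MEMBER's operator `Δ′_a(U; parKnitY)` (def-Y's `Node00.OpsYDeltaPrimeA.deltaPrimeAY` at the member's knit table `B9B8AveragingJunction.parKnitY`).  The editions
«KE₁₀X-A»…«KE₁₄X-A» pinned `O` to `GpDirY x □ (parKnitY x) Ω₀(□)` — the (α) letter, whose averaging legs are the MEMBER's and are flat on `Ω₀(□) ∖ NearH(□)` (node00-def-Y's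
(T-□) word, `Node00.OpsYCubeKnitPar`).  Print's object for the sequence `{Ω_n(□)}` reads the legs at the CUBE SEQUENCE's levels: the (β) letter
`GpDirY i □ (parKnitCubeY i □) S` (def-Y ✓`Node00.OpsYCubeKnitPar.parKnitCubeY`; dag-n06-c's estimate units key on it).  THIS FILE supplies the four law rows and the
positivity row AT THE (β) LETTER, by name:
* §1 LOCALITY — `blkHullCubeY i □ S` (the `𝔅_□`-block hull of a site set) and ★ `GpDirY_parKnitCubeY_congr_of_agree`: `G′_□(U; parKnitCubeY) = G′_□(U′; parKnitCubeY)` as soon as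
  `U ≡ U′` at the bonds of the sites of `S` and at the bonds of the sites of `blkHullCubeY i □ S` (def-Y's ✓`GpDirY_congr_of_agree` with its transporter clause discharged by
  dag-n06-c's ✓`B9Eq359CubeKernelsKnitAtOne.avgTrCubeY_parKnitCubeY_congr_of_agree_block` — every leg lives in ONE cube block); ★ `GpDirY_parKnitCubeY_congr_of_agreeWalkYO`,
  the member edition from the walk reading's agreement predicate (`hOagr`).
* §2 ROW ∕ COLUMN AGREEMENT WITH THE MEMBER LETTER — at every row `z` where the cube sequence has the member's level (`lev_□ z = lev z`, all of `NearH(□)`,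
  ✓`B9CubeLettersOpsL0.levCubeY_eq_levY_of_nearH`) the member operator does not see the difference of the two tables: `Δ′_a(U; parKnitCubeY □)Λ z = Δ′_a(U; parKnitY)Λ z`
  (def-Y ✓`parKnitCubeY_eq_parKnitY_of_lev_eq` at `z`, at its corner — corner constancy ✓`levCubeY_cornerY` ∕ ✓`levY_cornerY` — and at its averaging partners, which share
  its block); hence ★★ `cutMulY_deltaPrimeAY_GpDirY_parKnitCubeY_cutMulY` ∕ ★★ `cutMulY_GpDirY_parKnitCubeY_deltaPrimeAY_cutMulY`:
  `h Δ′_a(U; parKnitY) G′_□(U; parKnitCubeY) h = h² = h G′_□(U; parKnitCubeY) Δ′_a(U; parKnitY) h` for `h` supported in `S` near □, from `IsUnit (padDeltaCubeY … S U)` alone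
  (E's ✓`cutMulY_deltaPrimeAY_GpDirY_cutMulY`, F's ✓`cutMulY_GpDirY_deltaPrimeAY_cutMulY` at `par := parKnitCubeY □`), and both at `h_□` (`localInverse_laws_hTY_GpDirY_parKnitCubeY`)
  — the `hOloc` ∕ `hOlocT` rows.
* §3 POSITIVITY ON EVERY EXTERIOR — ★ `parKnitCubeY_corner_transport` (a covariantly constant `Φ` is transported to the corner of EVERY cube block: dag-n06-c's
  ✓`parKnitCubeY_blkCornerCubeY` + dag-n06-j's ✓`compT_flat`), `deltaPrimeACubeY_posDefTr_of_corner_transport` (r05's sum of squares ✓`trIP_deltaPrimeACubeY_eq` read with the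
  corner-pair premise only — the cube twin of dag-n06-j's ✓`deltaPrimeAY_posDefTr_of_corner_transport`), ★★ `deltaPrimeACubeY_parKnitCubeY_posDefTr` and ★★★
  `isUnit_padDeltaCubeY_parKnitCubeY (hGU) (hU) (S)`: `IsUnit (Ω₀Δ′_{a,□}(U; parKnitCubeY)Ω₀ ⊕ 1)` for EVERY `S ⊆ T_η` and every `G`-valued `U`, `G ≤ U(N)` — the `hUnitD` row,
  simpler than the (α) twin ✓`B9CubeDirInversePosOnNearHY.isUnit_padDeltaCubeY_parKnitY` (there only the block through □'s witness transports; here every block does).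
  (`hOsym` at the (β) letter is def-Y's ✓`Node00.OpsYCubeKnitPar.GpDirY_parKnitCubeY_isSymmTr_of_le`, not restated.)

* §4 (v1.1) THE 𝔅_□-BLOCK HULL OF PRINT's PLACEMENT IS THE PLACEMENT: `blkHullCubeY i □ (dirDomY i □) ⊆ dirDomY i □` (a cube block of level `n ≥ 1` lies in
  `C₁(□) ⊆ Ω₀(□)` — ✓`le_prof_iff`, ✓`mem_dirDomC_of_InC`; a level-0 block is a point), hence the heads' reach row `hSblk` FOLLOWS from `hSnear` (`blkHullCubeY_dirDomY_subset`).
HONEST SCOPE.  Exact bookkeeping and positivity algebra over landed modules (no estimate of [B9] Thm 3.1 ∕ Cor. 3.6; no choice of `S`; the inclusion `blkHullCubeY … Ω₀(□) ⊆ near □`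
is cover geometry left to the consumer).  Count-neutral; N06 NOT discharged; nothing continuum ∕ OS ∕ mass gap ∕ Clay.  Cell `pub-ymgap` (D-0062), Track A node N06 [B9], seat
`pub-ymgap-dag-n06-d` (g33), 2026-08-31; NEW file; nothing landed is modified.
-/

noncomputable section

namespace Literature.MathematicalPhysics.QuantumFieldTheory.Balaban1983to89.B9CubeDirInverseKnitCubeLawsY

open B7Prop1Explicit renaming Site → LSite
open Literature.MathematicalPhysics.QuantumLattice (blockBase blockMap)
open B8Eq119TwistedAxial (bgT)
open B4Reflection242 (blk)
open B6KLevelCensusIndexV1 (KIdx)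
open B6Cover236MultiLevelBlocks (cubes)
open B9B8CarrierDictionary (liftCfg)
open B9B8AveragingJunction (parKnitY blockMap_iterate blk_eq_blockMap liftFun_chart_apply)
open B9CubeLettersOpsL0 (cubeFamY levCubeY levCubeY_eq_levY_of_nearH avgCoeffCubeY avgTrCubeY deltaPrimeACubeY)
open B9CubeLettersBondOpsL0 (BlkCubeY blkCornerCubeY)
open B9CubeSequence408 (NearH)
open B9Thm37CubeCoverCommutators (cutMulY cutMulY_apply hTY stencilY mem_stencilY_of_avgCoeffY_ne_zero)
open B9Cor36GCubeLocDefectTransfer (nearH_of_hTY_ne_zero)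
open B9Eq39Adjoint (R R_zero)
open B9Thm311ReadingCoords (trIP PosDefTr isUnit_of_posDefTr)
open B9Thm311DeltaPrimePos (trIP_self_nonneg trIP_self_pos re_trace_conjTranspose_mul_self_nonneg eq_zero_of_re_trace_conjTranspose_mul_self_eq_zero)
open B9Thm311CubeLettersFirstThree (trIP_deltaPrimeACubeY_eq levC_wCube_pos)
open B9Thm311PositivityKnitLetter (compT_flat liftFun_flat)
open B9CubeDirInversePosOnNearHY (posDefTr_dirPadY_cubeProjY_of_posOn)
open B9Eq359CubeKernelsKnitAtOne (parKnitCubeY_blkCornerCubeY avgTrCubeY_parKnitCubeY_congr_of_agree_block)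
open B6MultiLevelBoxOperator (levC)
open B9Thm31CubeLocalFlat (wCube)
open B9PinMembersKLevelV1 (MemberY)
open B9WalkLettersOpsO (agreeWalkYO)
open Node00
open Node00.OpsYLocalInverse (dirPadY cubeProjY)
open Node00.OpsYCubeDirInverse (GpDirY padDeltaCubeY GpDirY_congr_of_agree padDeltaCubeY_congr_of_agree cutMulY_deltaPrimeAY_GpDirY_cutMulY)
open Node00.OpsYCubeDirInverseSymm (cutMulY_GpDirY_deltaPrimeAY_cutMulY)
open Node00.OpsYLocalInverseSeq (nearH_of_mem_stencilY_hTY)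
open Node00.OpsYCubeKnitPar (parKnitCubeY parKnitCubeY_inv parKnitCubeY_mem_unitaryUnits_of_le parKnitCubeY_eq_parKnitY_of_lev_eq levCubeY_cornerY levY_cornerY)
open scoped Matrix Matrix.Norms.L2Operator

variable {d ℓ : ℕ} {hd : 1 ≤ d + 1} {hL : Odd (ℓ + 1) ∧ 1 < ℓ + 1} {b₀ b₁ : ℝ}
variable {𝔸 : Type} [NormedRing 𝔸] [NormedAlgebra ℂ 𝔸] [CompleteSpace 𝔸]

/-! ## §1 Locality in `U`: `G′_□(U; parKnitCubeY)` from bond agreement on `S` and on the `𝔅_□`-block hull of `S` -/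

section Locality

variable (i : KIdx d ℓ hd hL b₀ b₁) (q : ↥(cubes (toKT i).D.toDomains))

open Classical in
/-- **THE `𝔅_□`-BLOCK HULL `blkHullCubeY i □ S`** of a site set: the box sites sharing a block of the cube sequence `{Ω_n(□)}` with a site of `S` — the sites whose bond variables
the legs of `Ω₀Δ′_{a,□}(U; parKnitCubeY)Ω₀`, `Ω₀ = 𝟙_S`, read (every averaging partner and every leg of a row `z ∈ S` lives in the cube block of `z`).
[cite: Balaban1985BackgroundPropagators, p.394 L30–33, (3.19) p.393, p.409 l.1–5; Balaban1985Averaging, p.24] -/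
def blkHullCubeY (S : Finset (SiteY i)) : Finset (SiteY i) :=
  Finset.univ.filter fun v => ∃ z ∈ S,
    B6Geom246MultiLevelBoxL0.blkOf (cubeFamY i q).toDomains v = B6Geom246MultiLevelBoxL0.blkOf (cubeFamY i q).toDomains z

/-- membership in the block hull, unfolded. [cite: Balaban1985BackgroundPropagators, p.394 L30–33, bookkeeping] -/
theorem mem_blkHullCubeY {S : Finset (SiteY i)} {v : SiteY i} :
    v ∈ blkHullCubeY i q S ↔ ∃ z ∈ S,
      B6Geom246MultiLevelBoxL0.blkOf (cubeFamY i q).toDomains v = B6Geom246MultiLevelBoxL0.blkOf (cubeFamY i q).toDomains z := by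
  classical
  simp only [blkHullCubeY, Finset.mem_filter, Finset.mem_univ, true_and]

/-- `S` lies in its block hull. [cite: Balaban1985BackgroundPropagators, p.394 L30–33, bookkeeping] -/
theorem subset_blkHullCubeY (S : Finset (SiteY i)) : S ⊆ blkHullCubeY i q S := fun z hz =>
  (mem_blkHullCubeY i q).2 ⟨z, hz, rfl⟩

/-- the block hull is monotone in the site set. [cite: Balaban1985BackgroundPropagators, p.394 L30–33, bookkeeping] -/
theorem blkHullCubeY_mono {S S' : Finset (SiteY i)} (h : S ⊆ S') : blkHullCubeY i q S ⊆ blkHullCubeY i q S' := by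
  intro v hv
  obtain ⟨z, hz, hb⟩ := (mem_blkHullCubeY i q).1 hv
  exact (mem_blkHullCubeY i q).2 ⟨z, h hz, hb⟩

/-- ★★ **PRINT's «`G′_□(U)` DEPENDS ON `U` RESTRICTED TO `Ω₀`» AT THE CUBE SEQUENCE's KNIT LETTER, FROM BOND AGREEMENT ALONE**: if `U ≡ U′` at the box bonds (forward and
backward) of the sites of `S` and at the box bonds of the sites of `blkHullCubeY i □ S`, then `G′_□(U; parKnitCubeY) = G′_□(U′; parKnitCubeY)` (def-Y's ✓`GpDirY_congr_of_agree`, its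
transporter clause discharged by dag-n06-c's ✓`avgTrCubeY_parKnitCubeY_congr_of_agree_block`). [cite: Balaban1985BackgroundPropagators, p.394 L30–33, (3.19) p.393, (3.24) p.394,
p.409 l.1–5; Balaban1985Averaging, p.24] -/
theorem GpDirY_parKnitCubeY_congr_of_agree (S : Finset (SiteY i)) {U U' : CfgY 𝔸 i}
    (hU : ∀ z ∈ S, ∀ μ, UboxY i U μ z = UboxY i U' μ z ∧ UboxY i U μ ((shiftY i μ).symm z) = UboxY i U' μ ((shiftY i μ).symm z))
    (hR : ∀ v ∈ blkHullCubeY i q S, ∀ μ, UboxY i U μ v = UboxY i U' μ v) :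
    GpDirY i q (parKnitCubeY i q) S U = GpDirY i q (parKnitCubeY i q) S U' :=
  GpDirY_congr_of_agree i q (parKnitCubeY i q) S hU fun z hz _ hw =>
    avgTrCubeY_parKnitCubeY_congr_of_agree_block i q hw fun v μ hv _ => hR v ((mem_blkHullCubeY i q).2 ⟨z, hz, hv⟩) μ

/-- the regime object `Ω₀Δ′_{a,□}(U; parKnitCubeY)Ω₀ ⊕ 1` is local in the same sense. [cite: Balaban1985BackgroundPropagators, p.394 L30–33, bookkeeping] -/
theorem padDeltaCubeY_parKnitCubeY_congr_of_agree (S : Finset (SiteY i)) {U U' : CfgY 𝔸 i}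
    (hU : ∀ z ∈ S, ∀ μ, UboxY i U μ z = UboxY i U' μ z ∧ UboxY i U μ ((shiftY i μ).symm z) = UboxY i U' μ ((shiftY i μ).symm z))
    (hR : ∀ v ∈ blkHullCubeY i q S, ∀ μ, UboxY i U μ v = UboxY i U' μ v) :
    padDeltaCubeY i q (parKnitCubeY i q) S U = padDeltaCubeY i q (parKnitCubeY i q) S U' :=
  padDeltaCubeY_congr_of_agree i q (parKnitCubeY i q) S hU fun z hz _ hw =>
    avgTrCubeY_parKnitCubeY_congr_of_agree_block i q hw fun v μ hv _ => hR v ((mem_blkHullCubeY i q).2 ⟨z, hz, hv⟩) μ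

end Locality

section Member

variable {Mstar : ℕ} (x : MemberY d ℓ hd hL b₀ b₁ Mstar) (B : B9.Backgrounds) (cfg : B.Cfg → CfgY 𝔸 x.toKIdx) (parS : SiteParY 𝔸 x.toKIdx)

/-- ★★ **THE `hOagr` ROW AT THE (β) LETTER**: the walk reading's agreement predicate `agreeWalkYO … near □` (bond clause) gives `G′_□(U; parKnitCubeY □) = G′_□(U′; parKnitCubeY □)`
whenever the reading domain `near □` contains `S = Ω₀(□)` and its `𝔅_□`-block hull (any walk transporter `parS`; its transporter clause is not needed).
[cite: Balaban1985BackgroundPropagators, p.394 L30–33, p.410 L14–15 («G′_□ depends on U restricted to Ω₀(□) ⊂ □̃⁵»), (3.88) p.409] -/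
theorem GpDirY_parKnitCubeY_congr_of_agreeWalkYO (near : ↥(cubes x.toKIdx.D.toDomains) → Finset (SiteY x.toKIdx)) (c : ↥(cubes x.toKIdx.D.toDomains))
    (S : Finset (SiteY x.toKIdx)) (hS : S ⊆ near c) (hR : blkHullCubeY x.toKIdx c S ⊆ near c) {U U' : B.Cfg}
    (h : agreeWalkYO x B cfg parS near c U U') :
    GpDirY x.toKIdx c (parKnitCubeY x.toKIdx c) S (cfg U) = GpDirY x.toKIdx c (parKnitCubeY x.toKIdx c) S (cfg U') :=
  GpDirY_parKnitCubeY_congr_of_agree x.toKIdx c S (fun z hz μ => h.1 z (hS hz) μ) (fun v hv μ => (h.1 v (hR hv) μ).1)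

end Member

/-! ## §2 Row ∕ column agreement of `Δ′_a(U; parKnitCubeY □)` with `Δ′_a(U; parKnitY)` where `lev_□ = lev`; (3.87)–(3.88) against the member operator -/

section Rows

variable (i : KIdx d ℓ hd hL b₀ b₁) (q : ↥(cubes (toKT i).D.toDomains))

omit [NormedRing 𝔸] [NormedAlgebra ℂ 𝔸] [CompleteSpace 𝔸] in
/-- an averaging partner `w` of a row `z` with `lev_□ z = lev z` has `lev_□ w = lev w` too (both families' territories are unions of blocks of their own level,
`lev_eq_of_blk_eq`, and `w ∼_{lev z} z`). [cite: Balaban1984PropagatorsII, (2.1)+(2.3) p.224, (2.14) p.225; Balaban1985BackgroundPropagators, p.408] -/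
theorem levCubeY_eq_levY_of_avgCoeffY_ne_zero {z w : SiteY i} (hz : levCubeY i q z = levY i z) (hw : avgCoeffY i z w ≠ 0) :
    levCubeY i q w = levY i w := by
  have hblk : blk ((ℓ + 1) ^ levY i z) w.1 = blk ((ℓ + 1) ^ levY i z) z.1 := by
    by_contra hne
    exact hw (by rw [avgCoeffY, B4Reflection242.avgK, if_neg hne])
  have hlw : levY i w = levY i z := (toKT i).D.lev_eq_of_blk_eq z.2 w.2 hblk
  have hcw : levCubeY i q w = levCubeY i q z := (cubeFamY i q).lev_eq_of_blk_eq z.2 w.2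
    (by rw [show (cubeFamY i q).lev z.1 = levY i z from hz]; exact hblk)
  rw [hcw, hz, hlw]

/-- ★ on such a row the member's averaging transporter does not see the difference of the two tables:
`U(Γ_{z,c})U(Γ_{c,w})` read from `parKnitCubeY □` equals the one read from `parKnitY` (`c` the member corner of `z`; level agreement at `z`, `c`, `w`).
[cite: Balaban1985BackgroundPropagators, (3.19) p.393, (3.24) p.394, p.408–409] -/
theorem avgTrY_parKnitCubeY_eq (U : CfgY 𝔸 i) {z w : SiteY i} (hz : levCubeY i q z = levY i z) (hw : avgCoeffY i z w ≠ 0) :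
    avgTrY i (parKnitCubeY i q) U z w = avgTrY i (parKnitY i) U z w := by
  have hw' := levCubeY_eq_levY_of_avgCoeffY_ne_zero i q hz hw
  have hc : levCubeY i q (cornerY i (levY i z) z) = levY i (cornerY i (levY i z) z) := by
    have h := levCubeY_cornerY i q z
    rw [hz] at h
    rw [h, levY_cornerY]
  unfold avgTrY
  rw [parKnitCubeY_eq_parKnitY_of_lev_eq i q U hz hc, parKnitCubeY_eq_parKnitY_of_lev_eq i q U hc hw']

/-- ★★ **ROW AGREEMENT**: at a row `z` with `lev_□ z = lev z`, `Δ′_a(U; parKnitCubeY □)Λ z = Δ′_a(U; parKnitY)Λ z` for every `U`, `Λ`.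
[cite: Balaban1985BackgroundPropagators, (3.24) p.394, (3.88) p.409] -/
theorem deltaPrimeAY_parKnitCubeY_apply_eq_of_lev_eq (U : CfgY 𝔸 i) (Λ : SiteY i → 𝔸) {z : SiteY i} (hz : levCubeY i q z = levY i z) :
    deltaPrimeAY i (parKnitCubeY i q) U Λ z = deltaPrimeAY i (parKnitY i) U Λ z := by
  rw [deltaPrimeAY_apply, deltaPrimeAY_apply]
  refine congrArg _ (Finset.sum_congr rfl fun w _ => ?_)
  by_cases hw : avgCoeffY i z w = 0
  · rw [hw, Complex.ofReal_zero, zero_smul, zero_smul]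
  · rw [avgTrY_parKnitCubeY_eq i q U hz hw]

/-- ★★ in particular ON EVERY ROW NEAR □ (`lev_□ = lev` on `NearH(□)`). [cite: Balaban1985BackgroundPropagators, p.408 (□³ ⊂ Ω_j(□)), (3.88) p.409] -/
theorem deltaPrimeAY_parKnitCubeY_apply_eq_of_nearH (U : CfgY 𝔸 i) (Λ : SiteY i → 𝔸) {z : SiteY i} (hz : NearH q z.1) :
    deltaPrimeAY i (parKnitCubeY i q) U Λ z = deltaPrimeAY i (parKnitY i) U Λ z :=
  deltaPrimeAY_parKnitCubeY_apply_eq_of_lev_eq i q U Λ (levCubeY_eq_levY_of_nearH i q hz)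

/-- ★ ROW FORM: for a real cut-off `h` supported near □, `h·Δ′_a(U; parKnitCubeY □) = h·Δ′_a(U; parKnitY)` as operators.
[cite: Balaban1985BackgroundPropagators, (3.87)–(3.88) p.409] -/
theorem cutMulY_mul_deltaPrimeAY_parKnitCubeY_eq (U : CfgY 𝔸 i) (h : SiteY i → ℝ) (hh : ∀ z, h z ≠ 0 → NearH q z.1) :
    cutMulY h * deltaPrimeAY i (parKnitCubeY i q) U = cutMulY h * deltaPrimeAY i (parKnitY i) U := by
  refine LinearMap.ext fun Λ => funext fun z => ?_
  rw [Module.End.mul_apply, Module.End.mul_apply, cutMulY_apply, cutMulY_apply]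
  by_cases hz : h z = 0
  · rw [hz, Complex.ofReal_zero, zero_smul, zero_smul]
  · rw [deltaPrimeAY_parKnitCubeY_apply_eq_of_nearH i q U Λ (hh z hz)]

/-- ★ COLUMN FORM: for a real cut-off `h` whose stencil-thickened support lies near □, `Δ′_a(U; parKnitCubeY □)·h = Δ′_a(U; parKnitY)·h` as operators (a row `z` either
lies near □, or no averaging partner of `z` meets `supp h` and the two averaging sums both read `h·Λ = 0`). [cite: Balaban1985BackgroundPropagators, (3.88) p.409, p.410 l.14–15] -/
theorem deltaPrimeAY_parKnitCubeY_mul_cutMulY_eq (U : CfgY 𝔸 i) (h : SiteY i → ℝ)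
    (hh : ∀ z w : SiteY i, w ∈ stencilY i z → h w ≠ 0 → NearH q z.1) :
    deltaPrimeAY i (parKnitCubeY i q) U * cutMulY h = deltaPrimeAY i (parKnitY i) U * cutMulY h := by
  refine LinearMap.ext fun Λ => funext fun z => ?_
  rw [Module.End.mul_apply, Module.End.mul_apply]
  by_cases hz : NearH q z.1
  · exact deltaPrimeAY_parKnitCubeY_apply_eq_of_nearH i q U _ hz
  · rw [deltaPrimeAY_apply, deltaPrimeAY_apply]
    refine congrArg _ (Finset.sum_congr rfl fun w _ => ?_)
    by_cases hw : avgCoeffY i z w = 0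
    · rw [hw, Complex.ofReal_zero, zero_smul, zero_smul]
    · have h0 : h w = 0 := by
        by_contra hne
        exact hz (hh z w (mem_stencilY_of_avgCoeffY_ne_zero i z w hw) hne)
      rw [cutMulY_apply, h0, Complex.ofReal_zero, zero_smul, R_zero, R_zero]

/-- ★★ **THE `hOloc` ROW AT THE (β) LETTER — (3.87)–(3.88) AGAINST THE MEMBER OPERATOR**: for a cut-off `h` supported in `S` and near □ and the padded compression
`Ω₀Δ′_{a,□}(U; parKnitCubeY □)Ω₀ ⊕ 1` a unit, `h·Δ′_a(U; parKnitY)·G′_□(U; parKnitCubeY □)·h = h²` (row form + E's ✓`cutMulY_deltaPrimeAY_GpDirY_cutMulY` at `par := parKnitCubeY □`).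
[cite: Balaban1985BackgroundPropagators, (3.87)–(3.88) p.409, p.394 L24–33, p.408 l.40–p.409 l.5] -/
theorem cutMulY_deltaPrimeAY_GpDirY_parKnitCubeY_cutMulY {S : Finset (SiteY i)} {U : CfgY 𝔸 i}
    (hU : IsUnit (padDeltaCubeY i q (parKnitCubeY i q) S U)) (h : SiteY i → ℝ) (hS : ∀ z, h z ≠ 0 → z ∈ S) (hh : ∀ z, h z ≠ 0 → NearH q z.1) :
    cutMulY h * deltaPrimeAY i (parKnitY i) U * GpDirY i q (parKnitCubeY i q) S U * cutMulY h = cutMulY h * cutMulY h := by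
  rw [← cutMulY_mul_deltaPrimeAY_parKnitCubeY_eq i q U h hh]
  exact cutMulY_deltaPrimeAY_GpDirY_cutMulY i q (parKnitCubeY i q) hU h hS hh

/-- ★★ **THE `hOlocT` ROW AT THE (β) LETTER — THE TRANSPOSED LAW**: `h·G′_□(U; parKnitCubeY □)·Δ′_a(U; parKnitY)·h = h²` for a cut-off supported in `S` whose stencil-thickened
support lies near □ (column form + F's ✓`cutMulY_GpDirY_deltaPrimeAY_cutMulY` at `par := parKnitCubeY □`). [cite: Balaban1985BackgroundPropagators, (3.87)–(3.88), (3.90) p.409] -/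
theorem cutMulY_GpDirY_parKnitCubeY_deltaPrimeAY_cutMulY {S : Finset (SiteY i)} {U : CfgY 𝔸 i}
    (hU : IsUnit (padDeltaCubeY i q (parKnitCubeY i q) S U)) (h : SiteY i → ℝ) (hS : ∀ z, h z ≠ 0 → z ∈ S)
    (hh : ∀ z w : SiteY i, w ∈ stencilY i z → h w ≠ 0 → NearH q z.1) :
    cutMulY h * GpDirY i q (parKnitCubeY i q) S U * deltaPrimeAY i (parKnitY i) U * cutMulY h = cutMulY h * cutMulY h := by
  rw [mul_assoc (cutMulY h * GpDirY i q (parKnitCubeY i q) S U), ← deltaPrimeAY_parKnitCubeY_mul_cutMulY_eq i q U h hh, ← mul_assoc]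
  exact cutMulY_GpDirY_deltaPrimeAY_cutMulY i q (parKnitCubeY i q) hU h hS hh

/-- ★★★ **BOTH LOCAL-INVERSE LAWS OF `G′_□(U; parKnitCubeY □)` AT THE PARTITION OF RECORD `h_□ = hTY i □`, AGAINST THE MEMBER's `Δ′_a(U; parKnitY)`** — the binders
`hOloc` ∕ `hOlocT` of the N06 knit certificate at the (β) site letter, from `supp h_□ ⊆ S` and `IsUnit (Ω₀Δ′_{a,□}(U; parKnitCubeY □)Ω₀ ⊕ 1)` alone
(`supp h_□` and its stencil lie near □: ✓`nearH_of_hTY_ne_zero`, ✓`nearH_of_mem_stencilY_hTY`). [cite: Balaban1985BackgroundPropagators, (3.87)–(3.88) p.409, p.408 l.35–p.409 l.5, Cor. 3.6 p.408] -/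
theorem localInverse_laws_hTY_GpDirY_parKnitCubeY {S : Finset (SiteY i)} (hS : ∀ z, hTY i q z ≠ 0 → z ∈ S) {U : CfgY 𝔸 i}
    (hU : IsUnit (padDeltaCubeY i q (parKnitCubeY i q) S U)) :
    cutMulY (hTY i q) * deltaPrimeAY i (parKnitY i) U * GpDirY i q (parKnitCubeY i q) S U * cutMulY (hTY i q) = cutMulY (hTY i q) * cutMulY (hTY i q) ∧
    cutMulY (hTY i q) * GpDirY i q (parKnitCubeY i q) S U * deltaPrimeAY i (parKnitY i) U * cutMulY (hTY i q) = cutMulY (hTY i q) * cutMulY (hTY i q) :=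
  ⟨cutMulY_deltaPrimeAY_GpDirY_parKnitCubeY_cutMulY i q hU (hTY i q) hS fun _ hz => nearH_of_hTY_ne_zero i q hz,
    cutMulY_GpDirY_parKnitCubeY_deltaPrimeAY_cutMulY i q hU (hTY i q) hS fun _ _ hw hz => nearH_of_mem_stencilY_hTY i q hw hz⟩

end Rows

/-! ## §3 Positivity of `Δ′_{a,□}(U; parKnitCubeY □)` and the unit premise of `G′_□(U; parKnitCubeY □)` on EVERY exterior -/

section Transport

variable (i : KIdx d ℓ hd hL b₀ b₁) (q : ↥(cubes (toKT i).D.toDomains))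

/-- ★★ **CORNER TRANSPORT AT `parKnitCubeY □`, EVERY CONFIGURATION, EVERY CUBE BLOCK**: if `∇_UΦ = 0` then `R(U(Γ^{(n)}_{y,z}))Φ(z) = Φ(c_s)` for every block `s = (n, y)`
of the cube sequence, its corner `c_s = Lⁿy` and every `z ∈ s` (the cube leg IS the composite transporter ✓`parKnitCubeY_blkCornerCubeY`, which transports flat sections
✓`compT_flat`). [cite: Balaban1985BackgroundPropagators, (3.19) p.393, p.395 («Δ′_a is positive»), p.409 l.1–5] -/
theorem parKnitCubeY_corner_transport (U : CfgY 𝔸 i) (Φ : SiteY i → 𝔸) (hΦ : ∀ μ, cdS i U μ Φ = 0) {s : BlkCubeY i q} {z : SiteY i}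
    (hz : B6Geom246MultiLevelBoxL0.blkOf (cubeFamY i q).toDomains z = s) :
    R (parKnitCubeY i q U (blkCornerCubeY i q s) z) (Φ z) = Φ (blkCornerCubeY i q s) := by
  have hanc : (blockMap (ℓ + 1))^[s.1.1] z.1 = s.1.2 := by
    rw [blockMap_iterate, ← blk_eq_blockMap]
    exact (B6Geom246MultiLevelBoxL0.blkOf_eq_iff_blk (cubeFamY i q).toDomains).1 hz
  have hcor : (blkCornerCubeY i q s).1 = ((((ℓ + 1 : ℕ) : ℤ)) ^ s.1.1) • s.1.2 := by
    funext μ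
    show (((ℓ + 1) ^ s.1.1 : ℕ) : ℤ) * s.1.2 μ = _
    rw [Pi.smul_apply, smul_eq_mul, Nat.cast_pow]
  rw [parKnitCubeY_blkCornerCubeY i q U hz, ← liftFun_chart_apply i Φ z, ← liftFun_chart_apply i Φ (blkCornerCubeY i q s), hcor, ← hanc]
  exact compT_flat (liftFun_flat i U Φ hΦ) (ℓ + 1) s.1.1 z.1

end Transport

section Pos

variable {N : ℕ} (i : KIdx d ℓ hd hL b₀ b₁) (q : ↥(cubes (toKT i).D.toDomains)) {G : Subgroup (Matrix (Fin N) (Fin N) ℂ)ˣ}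

/-- ★★ **`Δ′_{a,□}(U)` IS POSITIVE DEFINITE on an inverse-symmetric `G`-valued transporter table that transports flat sections FROM EVERY SITE TO THE CORNER OF ITS CUBE
BLOCK** (`G ≤ U(N)`, `G`-valued `U`) — r05's ✓`deltaPrimeACubeY_posDefTr_of_flat_transport` with the premise weakened to the corner pairs its proof reads (the cube twin of
dag-n06-j's ✓`deltaPrimeAY_posDefTr_of_corner_transport`): (3.24) for the sequence is a sum of squares (✓`trIP_deltaPrimeACubeY_eq`); if it vanishes then `∇_UΦ = 0` and every
transported block sum `= |s|·Φ(c_s)` vanishes, so `Φ(c_s) = 0` at every corner and, transporting back, `Φ ≡ 0`. [cite: Balaban1985BackgroundPropagators, (3.24) pp.394–395, p.409, Thm 3.11 p.416] -/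
theorem deltaPrimeACubeY_posDefTr_of_corner_transport (hG : G ≤ B7Prop2Explicit.unitaryUnits (Matrix (Fin N) (Fin N) ℂ))
    (par : SiteParY (Matrix (Fin N) (Fin N) ℂ) i) (U : CfgY (Matrix (Fin N) (Fin N) ℂ) i) (hinv : ∀ z z' : SiteY i, par U z z' = (par U z' z)⁻¹)
    (hpar : ∀ z w : SiteY i, par U z w ∈ G) (hU : ∀ μ x, U μ x ∈ G)
    (htr : ∀ Φ : SiteY i → Matrix (Fin N) (Fin N) ℂ, (∀ μ, cdS i U μ Φ = 0) → ∀ (s : BlkCubeY i q) (z : SiteY i),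
      B6Geom246MultiLevelBoxL0.blkOf (cubeFamY i q).toDomains z = s → R (par U (blkCornerCubeY i q s) z) (Φ z) = Φ (blkCornerCubeY i q s)) :
    PosDefTr (fun _ => (1 : ℝ)) (deltaPrimeACubeY i q par U) := by
  intro Φ hΦ
  set B : BlkCubeY i q → Matrix (Fin N) (Fin N) ℂ := fun s =>
    ∑ z ∈ Finset.univ.filter (fun z : SiteY i => B6Geom246MultiLevelBoxL0.blkOf (cubeFamY i q).toDomains z = s),
      R (par U (blkCornerCubeY i q s) z) (Φ z) with hBdef
  have hl : ∀ μ, 0 ≤ trIP (fun _ => (1 : ℝ)) (cdS i U μ Φ) (cdS i U μ Φ) := fun μ => trIP_self_nonneg _ (fun _ => one_pos) _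
  have ha : ∀ s : BlkCubeY i q, 0 ≤ levC d ℓ (wCube ℓ) s.1.1 * (Matrix.trace ((B s)ᴴ * B s)).re := fun s =>
    mul_nonneg (levC_wCube_pos (B9Cor35AtOneInverseLetters.one_le_ell i) s.1.1).le (re_trace_conjTranspose_mul_self_nonneg _)
  have hlap := Finset.sum_nonneg fun μ (_ : μ ∈ Finset.univ) => hl μ
  have havg := Finset.sum_nonneg fun s (_ : s ∈ Finset.univ) => ha s
  rw [trIP_deltaPrimeACubeY_eq i q hG par U hinv hpar hU Φ]
  refine (add_nonneg hlap havg).lt_of_ne fun h0 => hΦ ?_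
  -- (i) `∇_UΦ = 0`; (ii) every transported block sum vanishes
  have hcd : ∀ μ, cdS i U μ Φ = 0 := fun μ => by
    by_contra hne
    have h := (Finset.sum_eq_zero_iff_of_nonneg fun μ _ => hl μ).1 (by linarith) μ (Finset.mem_univ μ)
    exact (trIP_self_pos (fun _ : SiteY i => (1 : ℝ)) (fun _ => one_pos) hne).ne' h
  have hB : ∀ s, B s = 0 := fun s => by
    have h := (Finset.sum_eq_zero_iff_of_nonneg fun s _ => ha s).1 (by linarith) s (Finset.mem_univ s)
    exact eq_zero_of_re_trace_conjTranspose_mul_self_eq_zero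
      ((mul_eq_zero.1 h).resolve_left (levC_wCube_pos (B9Cor35AtOneInverseLetters.one_le_ell i) s.1.1).ne')
  -- (iii) by corner transport each block sum is `|s| • Φ(c_s)`, so `Φ(c_s) = 0`
  have hcorner : ∀ s : BlkCubeY i q, Φ (blkCornerCubeY i q s) = 0 := by
    intro s
    have hsum : B s = (((Finset.univ.filter
        (fun z : SiteY i => B6Geom246MultiLevelBoxL0.blkOf (cubeFamY i q).toDomains z = s)).card : ℕ) : ℂ) • Φ (blkCornerCubeY i q s) := by
      rw [hBdef, Nat.cast_smul_eq_nsmul, ← Finset.sum_const]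
      exact Finset.sum_congr rfl fun z hz => htr Φ hcd s z (Finset.mem_filter.1 hz).2
    rw [hB s] at hsum
    refine (smul_eq_zero.1 hsum.symm).resolve_left (Nat.cast_ne_zero.2 (Finset.card_ne_zero.2 ⟨blkCornerCubeY i q s, ?_⟩))
    rw [Finset.mem_filter]
    exact ⟨Finset.mem_univ _, B6Geom246MultiLevelBoxL0.blkOf_corner (cubeFamY i q).toDomains s⟩
  -- (iv) transport back from the corner: `Φ ≡ 0`
  funext z
  have h := htr Φ hcd (B6Geom246MultiLevelBoxL0.blkOf (cubeFamY i q).toDomains z) z rfl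
  rw [hcorner] at h
  have h' := congrArg (R (par U (blkCornerCubeY i q (B6Geom246MultiLevelBoxL0.blkOf (cubeFamY i q).toDomains z)) z)⁻¹) h
  rwa [B9Eq39Adjoint.R_inv_R, B9Eq39Adjoint.R_zero] at h'

/-- ★★ **`Δ′_{a,□}(U; parKnitCubeY □)` IS POSITIVE DEFINITE FOR EVERY `G`-VALUED BACKGROUND, `G ≤ U(N)`** — no smallness, no exterior, no `NearH`: the cube table is
inverse-symmetric (✓`parKnitCubeY_inv`), `U(N)`-valued (✓`parKnitCubeY_mem_unitaryUnits_of_le`) and transports flat sections to every cube corner (§3).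
[cite: Balaban1985BackgroundPropagators, (3.24) pp.394–395, p.394 L24–33, Thm 3.11 p.416, p.409 («G′_□(U)»)] -/
theorem deltaPrimeACubeY_parKnitCubeY_posDefTr (hGU : G ≤ B7Prop2Explicit.unitaryUnits (Matrix (Fin N) (Fin N) ℂ)) {U : CfgY (Matrix (Fin N) (Fin N) ℂ) i}
    (hU : ∀ μ x, U μ x ∈ G) : PosDefTr (fun _ => (1 : ℝ)) (deltaPrimeACubeY i q (parKnitCubeY i q) U) :=
  deltaPrimeACubeY_posDefTr_of_corner_transport i q le_rfl (parKnitCubeY i q) U (parKnitCubeY_inv i q U)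
    (parKnitCubeY_mem_unitaryUnits_of_le i q hGU hU) (fun μ x => hGU (hU μ x)) fun Φ hΦ _ _ hz => parKnitCubeY_corner_transport i q U Φ hΦ hz

/-- ★ hence `Δ′_{a,□}(U; parKnitCubeY □)` is invertible on the whole torus for every `G`-valued background (`GpCubeY i □ (parKnitCubeY i □) U` is its two-sided inverse).
[cite: Balaban1985BackgroundPropagators, (3.25) p.394, p.409] -/
theorem isUnit_deltaPrimeACubeY_parKnitCubeY (hGU : G ≤ B7Prop2Explicit.unitaryUnits (Matrix (Fin N) (Fin N) ℂ)) {U : CfgY (Matrix (Fin N) (Fin N) ℂ) i}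
    (hU : ∀ μ x, U μ x ∈ G) : IsUnit (deltaPrimeACubeY i q (parKnitCubeY i q) U) :=
  isUnit_of_posDefTr (deltaPrimeACubeY_parKnitCubeY_posDefTr i q hGU hU)

/-- ★★★ **THE UNIT PREMISE OF `G′_□(U; parKnitCubeY □)` ON EVERY EXTERIOR**: `IsUnit (Ω₀Δ′_{a,□}(U; parKnitCubeY □)Ω₀ ⊕ 1)` for EVERY `Ω₀ = S ⊆ T_η` (proper or not — print's
placement `Ω₀(□) = dirDomC` may wrap around a small torus) and every `G`-valued background, `G ≤ U(N)`: the `hUnitD` row of the N06 knit certificates at the (β) letter, with NO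
cover-geometry hypothesis (compression of a positive operator, ✓`posDefTr_dirPadY_cubeProjY_of_posOn`). [cite: Balaban1985BackgroundPropagators, p.394 L24–33 («Its inverse is denoted by G′»),
(3.24) pp.394–395, Cor. 3.6 p.408, p.409, Thm 3.11 p.416] -/
theorem isUnit_padDeltaCubeY_parKnitCubeY (hGU : G ≤ B7Prop2Explicit.unitaryUnits (Matrix (Fin N) (Fin N) ℂ)) {U : CfgY (Matrix (Fin N) (Fin N) ℂ) i}
    (hU : ∀ μ x, U μ x ∈ G) (S : Finset (SiteY i)) : IsUnit (padDeltaCubeY i q (parKnitCubeY i q) S U) :=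
  isUnit_of_posDefTr (posDefTr_dirPadY_cubeProjY_of_posOn i (fun _ => one_pos) S fun Φ _ hΦ =>
    deltaPrimeACubeY_parKnitCubeY_posDefTr i q hGU hU Φ hΦ)

end Pos

/-! ## §4 (v1.1) The `𝔅_□`-block hull of print's placement `Ω₀(□) = dirDomY` is `Ω₀(□)` itself: the reach row `hSblk` follows from `hSnear` -/

section Hull
open B9Cor35GpDirInputsAtOne (dirDomY)
open B9CubeSequence408 (InC prof le_prof_iff one_le_cube_level)
open B9CubeSequence408Mirrors (mem_dirDomC_of_InC)
open B9CubeLettersOpsL0 (oddMh)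
open B9Thm311CubeLettersFirstThree (levCubeY_eq_of_blkOf_eq)
variable (i : KIdx d ℓ hd hL b₀ b₁) (q : ↥(cubes (toKT i).D.toDomains))
/-- a level-0 block of the cube sequence is a single site. [cite: Balaban1984PropagatorsII, (2.1)+(2.3) p.224 («Λ₀»); Balaban1985BackgroundPropagators, p.408, bookkeeping] -/
theorem eq_of_blkOf_eq_of_levCubeY_eq_zero {z w : SiteY i}
    (h : B6Geom246MultiLevelBoxL0.blkOf (cubeFamY i q).toDomains w = B6Geom246MultiLevelBoxL0.blkOf (cubeFamY i q).toDomains z)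
    (hz : levCubeY i q z = 0) : w = z := by
  have hb := (B6Geom246MultiLevelBoxL0.blkOf_eq_iff_blk (cubeFamY i q).toDomains).1 h
  have hb' := (B6Geom246MultiLevelBoxL0.blkOf_eq_iff_blk (cubeFamY i q).toDomains).1 (rfl : B6Geom246MultiLevelBoxL0.blkOf (cubeFamY i q).toDomains z = _)
  rw [show (B6Geom246MultiLevelBoxL0.blkOf (cubeFamY i q).toDomains z).1.1 = 0 from hz, pow_zero, B4Lemma24ZeroBoxAlphaNeg.blk_one] at hb hb'
  exact Subtype.ext (hb.trans hb'.symm)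
/-- ★ a site set containing every site of cube level `≥ 1` contains its own `𝔅_□`-block hull (level-0 blocks are points; a block of level `n ≥ 1` consists of level-`n` sites, ✓`levCubeY_eq_of_blkOf_eq`). [cite: Balaban1984PropagatorsII, (2.1)+(2.3) p.224; Balaban1985BackgroundPropagators, p.408, bookkeeping] -/
theorem blkHullCubeY_subset_of_one_le_lev {S : Finset (SiteY i)} (hS : ∀ w : SiteY i, 1 ≤ levCubeY i q w → w ∈ S) : blkHullCubeY i q S ⊆ S := by
  intro w hw
  obtain ⟨z, hz, hb⟩ := (mem_blkHullCubeY i q).1 hw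
  rcases Nat.eq_zero_or_pos (levCubeY i q z) with h0 | hpos
  · rw [eq_of_blkOf_eq_of_levCubeY_eq_zero i q hb h0]; exact hz
  · exact hS w (by rw [levCubeY_eq_of_blkOf_eq i q hb]; exact hpos)
/-- ★ every site of cube level `≥ 1` lies in print's placement `Ω₀(□) = dirDomY i □` (`lev_□ = min(lev, prof_□) ≥ 1 ⇒ prof_□ ≥ 1 ⇔ x ∈ C₁(□) ⊆ Ω₀(□)`). [cite: Balaban1985BackgroundPropagators, p.408 («Ω_{n}(□) … Ω₀(□) ⊂ □⁵»), bookkeeping] -/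
theorem mem_dirDomY_of_one_le_levCubeY {w : SiteY i} (hw : 1 ≤ levCubeY i q w) : w ∈ dirDomY i q := by
  have hprof : 1 ≤ prof q w.1 := le_trans (show 1 ≤ min ((toKT i).D.lev w.1) (prof q w.1) from hw) (min_le_right _ _)
  exact mem_dirDomC_of_InC hL.1 (oddMh i) (toKT i).hMh (toKT i).hP q
    ((le_prof_iff hL.1 (oddMh i) (toKT i).hMh (toKT i).hP le_rfl (one_le_cube_level q) w.1).1 hprof)
/-- ★★ **THE `𝔅_□`-BLOCK HULL OF `Ω₀(□)` IS `Ω₀(□)`**: `blkHullCubeY i □ (dirDomY i □) ⊆ dirDomY i □` — at print's placement the reach row of the (β) heads adds nothing to `Ω₀(□) ⊆ near □`. [cite: Balaban1985BackgroundPropagators, p.394 L30–33 («depend on the configuration U restricted to Ω₀»), p.408, p.410 L14–15] -/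
theorem blkHullCubeY_dirDomY_subset : blkHullCubeY i q (dirDomY i q) ⊆ dirDomY i q :=
  blkHullCubeY_subset_of_one_le_lev i q fun _ hw => mem_dirDomY_of_one_le_levCubeY i q hw

end Hull

end Literature.MathematicalPhysics.QuantumFieldTheory.Balaban1983to89.B9CubeDirInverseKnitCubeLawsY

end
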